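import Summits.Ventures.CertifiedQuantumChemistry.Rows.NSector
import Literature.MathematicalPhysics.QuantumLattice.HubbardSzSectorMonotone
import HarnessLib

/-!
# Ventures/CertifiedQuantumChemistry — Rows/SpinSectors.lean: sector rows and the `N`-electron
# ground energy for every sector `(N_α, N_β)` (typer aside T-05 in general form)

HONEST FRAMING (verbatim): certified bounds for a stated model Hamiltonian in a stated basis; not a
claim about the real molecule beyond that model.

FANOUT row 57 (T-05, typer ASIDE; lead rulings K6 / SD-1 (c); FORMAT-qcl1 §7): "for `[H, S⃗] = 0`
the `N`-sector minimum is attained in the `M = (N mod 2)/2` sector ⇒ an `(N, M_min)`-row is an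
`N`-sector row". `Rows/NSector.lean` proved the closed-shell case that every filed row uses
(`Model.groundEnergy_eq_energy`: `E₀(H_F; 2n) = E(n, n)`). This file records the statement for ALL
sectors of the cell's model `F : Model k`; write `E(a, b) := Model.energy F a b`
(`= sectorGroundEnergy H_F a b`, the certified quantity of ruling K1) and
`E₀(N) := groundEnergy H_F N` (the `N`-electron ground energy a full-CI code reports):

* `Model.groundEnergy_le_energy` — `E₀(a + b) ≤ E(a, b)` for every realised sector (`a, b ≤ k`;
  no symmetry needed): an UPPER row in ANY sector bounds the `N = a + b` ground energy from above
  (`UpperRow.groundEnergy_le_of_sector`);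
* `Model.groundEnergy_eq_energy_of_le_succ` — for `|a − b| ≤ 1`: `E₀(a + b) = E(a, b)`; in
  particular `E₀(2n + 1) = E(n + 1, n) = E(n, n + 1)` (`Model.groundEnergy_eq_energy_odd`, `…_odd'`)
  and, uniformly in the parity, `E₀(N) = E(⌈N/2⌉, ⌊N/2⌋)` (`Model.groundEnergy_eq_energy_halves`); so
  a LOWER row (hence a bracket) in a sector with `|N_α − N_β| ≤ 1` is a row about `E₀(N)`
  (`LowerRow.le_groundEnergy_of_le_succ`, `Bracket.groundEnergy_mem_of_le_succ`);
* `Model.energy_symm` — `E(a, b) = E(b, a)` (spin exchange);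
* `Model.energy_le_energy_of_max_le` — `E(a', b') ≤ E(a, b)` whenever `a' + b' = a + b` and
  `max a' b' ≤ max a b` (equivalently `|a' − b'| ≤ |a − b|`): the sector energies are non-decreasing
  in `|S_z|`, so the row of a nearly balanced sector bounds EVERY sector of the same electron
  number from below (`LowerRow.le_energy_of_sameN`).

Mechanism (E. H. Lieb, PRL 62 (1989) 1201, proof of Theorem 1 — "every spin multiplet has a
representative at `S_z = 0` resp. `S_z = ½`"; E. H. Lieb, D. Mattis, J. Math. Phys. 3 (1962) 749,
§I — the rotation-invariance half of the ordering of energy levels; Helgaker–Jørgensen–Olsen (2000)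
§2.3.4 — spin properties of the spin-free Hamiltonian): `H_F` conserves `(N_α, N_β)`
(`Model.preservesSectors_hamiltonian`), commutes with `Ŝ_±`
(`Literature…molecularHamiltonian_commute_spinPlus` / `…Minus`, typer T-05 part 1) and is invariant
under the spin exchange `(p, σ) ↦ (p, 1 − σ)` (`relabel_spinSwap_molecularHamiltonian` below: `E_pq`
and `e_pqrs` are sums over the spin labels); the tree's GENERIC `SU(2)` ladder lemmas
(`Literature/MathematicalPhysics/QuantumLattice/HubbardSzSectorMonotone.lean`:
`minEnergyOn_szSector_sub_le` / `_add_le` / `_le_of_abs_le`; `HubbardSpinFlipSymmetry.lean`: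
`minEnergyOn_szSector_neg`) carry a sector component of a ground state to the balanced sectors
without changing its energy (each `Ŝ⁻` / `Ŝ⁺` step is injective while the walk stays on one side
of `S_z = 0`, up to `|S_z| = ½`). The generic statements — any Hermitian `H` on `Fock (Orb Λ)` with
these symmetries, in `sectorGroundEnergy` language — come first; the `Model` corollaries and the row
readings follow. Everything is PROVED (0 sorry); no definition, no claim node; nothing in this file
asserts any bound. No filed CERTIFIED row needs it today (all rows are closed-shell); it fixes the
K1 reading of open-shell rows for later `Certificates/` files.
-/

noncomputable section

namespace Summit.Ventures.CertifiedQuantumChemistry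

open Matrix Finset
open Literature.MathematicalPhysics.QuantumLattice Literature.MathematicalPhysics.QuantumChemistry
open scoped ComplexOrder

/-! ## Generic statements: a Hermitian `H` on the spinful Fock space conserving `(N↑, N↓)` -/

section Generic

variable {Λ : Type*} [LinearOrder Λ] [Fintype Λ]

/-- **The `N`-electron ground energy lies below every sector energy with `N_α + N_β = N`**:
`groundEnergy H (a + b) ≤ sectorGroundEnergy H a b` for `a, b ≤ |Λ|` (the unit sphere of the
sector is a nonempty part of the `N`-particle unit sphere). No symmetry of `H` is used.
(Lieb, PRL 62 (1989) 1201, proof of Thm 1; Tasaki (1998) Definition 2.1.) -/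
theorem groundEnergy_le_sectorGroundEnergy (H : Matrix (Finset (Orb Λ)) (Finset (Orb Λ)) ℂ)
    {a b : ℕ} (ha : a ≤ Fintype.card Λ) (hb : b ≤ Fintype.card Λ) :
    groundEnergy H (a + b) ≤ sectorGroundEnergy H a b := by
  classical
  obtain ⟨χ, hχK, hχ0⟩ :=
    Submodule.exists_mem_ne_zero_of_ne_bot (szSector_upDown_ne_bot (Λ := Λ) ha hb)
  rw [sectorGroundEnergy_def, Literature.MathematicalPhysics.QuantumLattice.groundEnergy,
    Matrix.minEnergyOn]
  refine csInf_le_csInf (LiebThm1.bddBelow_energySet H (a + b)) ?_ ?_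
  · obtain ⟨c, -, hc1⟩ := Literature.MathematicalPhysics.QuantumLattice.exists_smul_unit hχ0
    exact ⟨_, c • χ, Submodule.smul_mem _ c hχK, hc1, rfl⟩
  · rintro E ⟨φ, hφ, hφ1, rfl⟩
    exact ⟨φ, ((mem_szSector_iff _ _ _).1 hφ).1, hφ1, rfl⟩

/-- **`SU(2)`: the ground energy is attained in every nearly balanced sector.** For a Hermitian `H`
conserving `(N↑, N↓)` and commuting with `Ŝ_±`, and a realised sector `(a, b)` (`a, b ≤ |Λ|`) with
`|a − b| ≤ 1`: `sectorGroundEnergy H a b ≤ groundEnergy H (a + b)`. A ground state of the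
`(a + b)`-particle space has a nonzero component in some sector `(c, a + b − c)`, an eigenvector at
`E₀`, so `E(c, a + b − c) ≤ E₀` (Rayleigh–Ritz); the `Ŝ⁻` chain (`c ≥ a`) resp. the `Ŝ⁺` chain
(`c < a`) of `HubbardSzSectorMonotone` then moves the sector to `(a, b)` without raising the energy —
admissible because `|a − b| ≤ 1` keeps the walk injective. (Lieb, PRL 62 (1989) 1201, proof of
Thm 1; Lieb–Mattis (1962) §I.) -/
theorem sectorGroundEnergy_le_groundEnergy_of_su2 {H : Matrix (Finset (Orb Λ)) (Finset (Orb Λ)) ℂ}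
    (hH : H.IsHermitian) (hHs : PreservesSectors H) (hcommP : Commute H spinPlus)
    (hcommM : Commute H Literature.MathematicalPhysics.QuantumLattice.spinMinus)
    {a b : ℕ} (ha : a ≤ Fintype.card Λ) (hb : b ≤ Fintype.card Λ) (hab : a ≤ b + 1)
    (hba : b ≤ a + 1) :
    sectorGroundEnergy H a b ≤ groundEnergy H (a + b) := by
  classical
  -- a ground state `v` of the `(a + b)`-particle sector
  obtain ⟨α, -, hα⟩ : ∃ α : Finset Λ, α ⊆ univ ∧ α.card = a :=
    Finset.exists_subset_card_eq (by rwa [Finset.card_univ])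
  obtain ⟨β, -, hβ⟩ : ∃ β : Finset Λ, β ⊆ univ ∧ β.card = b :=
    Finset.exists_subset_card_eq (by rwa [Finset.card_univ])
  have hp : ∃ s : Finset (Orb Λ), s.card = a + b := ⟨pairSet α β, by rw [card_pairSet, hα, hβ]⟩
  have hinv : ∀ s s' : Finset (Orb Λ), ¬(s.card = a + b) → s'.card = a + b → H s s' = 0 := by
    intro s s' hs hs'
    by_contra h
    have := hHs s s' h
    apply hs
    rw [card_eq_upPart_add_downPart, this.1, this.2, ← card_eq_upPart_add_downPart, hs']
  obtain ⟨⟨v, hv, hv0, hHv⟩, -⟩ := Literature.MathematicalPhysics.QuantumLattice.sector_groundState H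
    hH (fun s : Finset (Orb Λ) => s.card = a + b) hp hinv (nParticleSubmodule (a + b))
    (fun v => Iff.rfl)
  have hvN : IsNParticle (a + b) v := hv
  have hE₀v : H *ᵥ v = ((groundEnergy H (a + b) : ℝ) : ℂ) • v := by
    rw [hHv, groundEnergy_eq_minEnergyOn H (a + b) (nParticleSubmodule (a + b)) fun ψ => Iff.rfl]
  -- some sector component `w = P_{(c, a + b - c)} v` is nonzero; it is an eigenvector at `E₀`
  obtain ⟨c, hc, hvc⟩ : ∃ c ∈ range (a + b + 1), sectorProj c (a + b - c) v ≠ 0 := by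
    by_contra h
    simp only [not_exists, not_and, not_not] at h
    exact hv0 ((sum_sectorProj_eq hvN).symm.trans (Finset.sum_eq_zero h))
  rw [mem_range] at hc
  have hws : IsInSector c (a + b - c) (sectorProj c (a + b - c) v) := isInSector_sectorProj _ _ _
  have hHw : H *ᵥ sectorProj c (a + b - c) v =
      ((groundEnergy H (a + b) : ℝ) : ℂ) • sectorProj c (a + b - c) v := by
    rw [hHs.mulVec_sectorProj, hE₀v, sectorProj_smul]
  obtain ⟨hcΛ, hcΛ'⟩ := le_card_of_isInSector hws hvc
  -- Rayleigh–Ritz: `E(c, a + b - c) ≤ E₀`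
  have hray : sectorGroundEnergy H c (a + b - c) ≤ groundEnergy H (a + b) :=
    sectorGroundEnergy_le_of_rayleigh hH hws hvc (u := groundEnergy H (a + b))
      (by rw [hHw, dotProduct_smul, smul_eq_mul, Complex.re_ofReal_mul])
  refine le_trans ?_ hray
  -- move the sector `(c, a + b - c)` to `(a, b)` along the spin ladder
  have hsum : c + (a + b - c) = a + b := by omega
  rw [sectorGroundEnergy_def, sectorGroundEnergy_def, hsum]
  rcases Nat.lt_or_ge c a with hca | hac
  · -- `Ŝ⁺` chain, `a - c` steps; admissible iff `c + 2 (a - c) ≤ (a + b - c) + 1`, i.e. `a ≤ b + 1`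
    have h := minEnergyOn_szSector_add_le hH hHs hcommP (N := a + b)
      (M := ((c : ℝ) - ((a + b - c : ℕ) : ℝ)) / 2) c (a + b - c) hsum rfl hcΛ' (a - c) (by omega)
    have e : ((c : ℝ) - ((a + b - c : ℕ) : ℝ)) / 2 + ((a - c : ℕ) : ℝ) = ((a : ℝ) - b) / 2 := by
      rw [Nat.cast_sub (show c ≤ a + b by omega), Nat.cast_sub hca.le]
      push_cast
      ring
    rwa [e] at h
  · -- `Ŝ⁻` chain, `c - a` steps; admissible iff `(a + b - c) + 2 (c - a) ≤ c + 1`, i.e. `b ≤ a + 1`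
    have h := minEnergyOn_szSector_sub_le hH hHs hcommM (N := a + b)
      (M := ((c : ℝ) - ((a + b - c : ℕ) : ℝ)) / 2) c (a + b - c) hsum rfl hcΛ (c - a) (by omega)
    have e : ((c : ℝ) - ((a + b - c : ℕ) : ℝ)) / 2 - ((c - a : ℕ) : ℝ) = ((a : ℝ) - b) / 2 := by
      rw [Nat.cast_sub (show c ≤ a + b by omega), Nat.cast_sub hac]
      push_cast
      ring
    rwa [e] at h

/-- **The `N`-electron ground energy is the energy of every nearly balanced sector**: for a
Hermitian `H` conserving `(N↑, N↓)` and commuting with `Ŝ_±`, `a, b ≤ |Λ|` and `|a − b| ≤ 1`,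
`groundEnergy H (a + b) = sectorGroundEnergy H a b`. Both parities at once: `E₀(2n) = E(n, n)` (the
tree's `groundEnergy_eq_minEnergyOn_szSector_of_su2`) and `E₀(2n + 1) = E(n + 1, n) = E(n, n + 1)`.
(Lieb, PRL 62 (1989) 1201, proof of Thm 1.) -/
theorem groundEnergy_eq_sectorGroundEnergy_of_su2 {H : Matrix (Finset (Orb Λ)) (Finset (Orb Λ)) ℂ}
    (hH : H.IsHermitian) (hHs : PreservesSectors H) (hcommP : Commute H spinPlus)
    (hcommM : Commute H Literature.MathematicalPhysics.QuantumLattice.spinMinus)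
    {a b : ℕ} (ha : a ≤ Fintype.card Λ) (hb : b ≤ Fintype.card Λ) (hab : a ≤ b + 1)
    (hba : b ≤ a + 1) :
    groundEnergy H (a + b) = sectorGroundEnergy H a b :=
  le_antisymm (groundEnergy_le_sectorGroundEnergy H ha hb)
    (sectorGroundEnergy_le_groundEnergy_of_su2 hH hHs hcommP hcommM ha hb hab hba)

/-- **Spin exchange**: for a spin-exchange-invariant `H` (`relabel Orb.spinSwap H = H`, the signed
orbital permutation `(x, σ) ↦ (x, 1 − σ)` of `FermionRelabelling`),
`sectorGroundEnergy H a b = sectorGroundEnergy H b a` (the tree's `minEnergyOn_szSector_neg`: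
`E(N, −M) = E(N, M)`). (Lieb, PRL 62 (1989) 1201, proof of Thm 1: "the Hamiltonian is symmetric
between the up and the down spins".) -/
theorem sectorGroundEnergy_symm_of_spinSwap {H : Matrix (Finset (Orb Λ)) (Finset (Orb Λ)) ℂ}
    (hswap : relabel (Orb.spinSwap : Orb Λ ≃ Orb Λ) H = H) (a b : ℕ) :
    sectorGroundEnergy H a b = sectorGroundEnergy H b a := by
  rw [sectorGroundEnergy_def, sectorGroundEnergy_def, add_comm b a,
    show ((b : ℝ) - a) / 2 = -(((a : ℝ) - b) / 2) by ring, minEnergyOn_szSector_neg hswap]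

/-- **Sector energies are non-decreasing in `|S_z|`.** For a Hermitian `H` conserving `(N↑, N↓)`,
commuting with `Ŝ⁻` and spin-exchange invariant, a realised sector `(a, b)` (`a, b ≤ |Λ|`) and any
`(a', b')` with `a' + b' = a + b`, `|a' − b'| ≤ |a − b|`:
`sectorGroundEnergy H a' b' ≤ sectorGroundEnergy H a b` (the tree's
`minEnergyOn_szSector_le_of_abs_le` in `(N_α, N_β)` coordinates). (Lieb–Mattis, J. Math. Phys. 3
(1962) 749, §I; Lieb, PRL 62 (1989) 1201, proof of Thm 1.) -/
theorem sectorGroundEnergy_le_of_abs_le {H : Matrix (Finset (Orb Λ)) (Finset (Orb Λ)) ℂ}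
    (hH : H.IsHermitian) (hHs : PreservesSectors H)
    (hcommM : Commute H Literature.MathematicalPhysics.QuantumLattice.spinMinus)
    (hswap : relabel (Orb.spinSwap : Orb Λ ≃ Orb Λ) H = H) {a b a' b' : ℕ}
    (ha : a ≤ Fintype.card Λ) (hb : b ≤ Fintype.card Λ) (hsum : a' + b' = a + b)
    (habs : |(a' : ℝ) - b'| ≤ |(a : ℝ) - b|) :
    sectorGroundEnergy H a' b' ≤ sectorGroundEnergy H a b := by
  rw [sectorGroundEnergy_def, sectorGroundEnergy_def, hsum]
  refine minEnergyOn_szSector_le_of_abs_le hH hHs hcommM hswap a b rfl rfl ha hb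
    ⟨(a : ℤ) - a', ?_⟩ ?_
  · have h : (a' : ℝ) + b' = a + b := by exact_mod_cast hsum
    push_cast
    linarith
  · rw [abs_div, abs_div, abs_two]
    linarith

end Generic

/-! ## Spin-exchange invariance of the second-quantized molecular Hamiltonian -/

section Molecular

variable {Λ : Type*} [LinearOrder Λ] [Fintype Λ]

/-- `E_pq = Σ_σ a†_{pσ} a_{qσ}` is a sum over the spin label, hence invariant under the spin exchange
`(x, σ) ↦ (x, 1 − σ)` (`Γ E_pq Γ⁻¹ = E_pq`). (Helgaker–Jørgensen–Olsen (2000) §2.3.4: `E_pq` is a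
singlet operator.) -/
theorem relabel_spinSwap_singletExcitation (p q : Λ) :
    relabel (Orb.spinSwap : Orb Λ ≃ Orb Λ) (singletExcitation p q) = singletExcitation p q := by
  rw [singletExcitation, map_sum]
  exact Fintype.sum_equiv (Equiv.swap (0 : Fin 2) 1) _ _ fun σ => by
    rw [map_mul, relabel_creation, relabel_annihilation, Orb.spinSwap_orb, Orb.spinSwap_orb]

/-- `e_pqrs = E_pq E_rs − δ_qr E_ps` is spin-exchange invariant. (Helgaker–Jørgensen–Olsen (2000)
§2.3.4, eq. (2.2.16).) -/
theorem relabel_spinSwap_twoElectronExcitation (p q r s : Λ) :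
    relabel (Orb.spinSwap : Orb Λ ≃ Orb Λ) (twoElectronExcitation p q r s) =
      twoElectronExcitation p q r s := by
  rw [twoElectronExcitation_eq_mul_sub, map_sub, map_mul, relabel_spinSwap_singletExcitation,
    relabel_spinSwap_singletExcitation]
  congr 1
  split_ifs
  · exact relabel_spinSwap_singletExcitation p s
  · exact map_zero _

/-- **The spin-free molecular Hamiltonian is symmetric between the up and the down spins**:
`Γ Ĥ Γ⁻¹ = Ĥ` for `Ĥ = Σ h_pq E_pq + ½ Σ g_pqrs e_pqrs + h_nuc·1` and the spin exchange `Γ`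
(`relabelVec Orb.spinSwap`). (Helgaker–Jørgensen–Olsen (2000) §2.3.4; Lieb, PRL 62 (1989) 1201,
proof of Thm 1.) -/
theorem relabel_spinSwap_molecularHamiltonian (h : Λ → Λ → ℂ) (g : Λ → Λ → Λ → Λ → ℂ) (hnuc : ℂ) :
    relabel (Orb.spinSwap : Orb Λ ≃ Orb Λ) (molecularHamiltonian h g hnuc) =
      molecularHamiltonian h g hnuc := by
  unfold molecularHamiltonian
  simp only [map_add, map_smul, map_sum, map_one, relabel_spinSwap_singletExcitation,
    relabel_spinSwap_twoElectronExcitation]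

end Molecular

/-! ## The cell's model `F : Model k`: all sectors -/

variable {k : ℕ}

/-- `H_F` is spin-exchange invariant. -/
theorem Model.relabel_spinSwap_hamiltonian (F : Model k) :
    relabel (Orb.spinSwap : Orb (Fin k) ≃ Orb (Fin k)) F.hamiltonian = F.hamiltonian :=
  relabel_spinSwap_molecularHamiltonian _ _ _

/-- **`E(a, b) = E(b, a)`** for every model (spin exchange; no symmetry of the integral tables is
needed, and off the physical range both sides are the junk value `0`). -/
theorem Model.energy_symm (F : Model k) (a b : ℕ) : F.energy a b = F.energy b a :=
  sectorGroundEnergy_symm_of_spinSwap F.relabel_spinSwap_hamiltonian a b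

/-- **`E₀(a + b) ≤ E(a, b)`** for every realised sector `a, b ≤ k` of every model (no symmetry). -/
theorem Model.groundEnergy_le_energy (F : Model k) {a b : ℕ} (ha : a ≤ k) (hb : b ≤ k) :
    groundEnergy F.hamiltonian (a + b) ≤ F.energy a b :=
  groundEnergy_le_sectorGroundEnergy F.hamiltonian (by simpa using ha) (by simpa using hb)

/-- `|a' − b'| ≤ |a − b|` from `max a' b' ≤ max a b` at equal sums (the form `omega` decides). -/
private theorem abs_sub_le_abs_sub_of_max_le {a b a' b' : ℕ} (hsum : a' + b' = a + b)
    (hmax : max a' b' ≤ max a b) : |(a' : ℝ) - b'| ≤ |(a : ℝ) - b| := by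
  obtain ⟨ha', hb'⟩ := max_le_iff.1 hmax
  have h2 : (a' : ℝ) + b' = a + b := by exact_mod_cast hsum
  rcases le_total a b with h | h
  · rw [max_eq_right h] at ha' hb'
    have ha'r : (a' : ℝ) ≤ b := by exact_mod_cast ha'
    have hb'r : (b' : ℝ) ≤ b := by exact_mod_cast hb'
    have hr : (a : ℝ) ≤ b := by exact_mod_cast h
    rw [abs_sub_comm (a : ℝ) b, abs_of_nonneg (by linarith : (0 : ℝ) ≤ b - a), abs_le]
    constructor <;> linarith
  · rw [max_eq_left h] at ha' hb'
    have ha'r : (a' : ℝ) ≤ a := by exact_mod_cast ha'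
    have hb'r : (b' : ℝ) ≤ a := by exact_mod_cast hb'
    have hr : (b : ℝ) ≤ a := by exact_mod_cast h
    rw [abs_of_nonneg (by linarith : (0 : ℝ) ≤ a - b), abs_le]
    constructor <;> linarith

/-- **Sector energies of a symmetric model are non-decreasing in `|N_α − N_β|` at fixed `N`**: for a
realised sector `(a, b)` (`a, b ≤ k`) and any `(a', b')` with `a' + b' = a + b` and
`max a' b' ≤ max a b` (i.e. `|a' − b'| ≤ |a − b|`; the target sector is then realised as well),
`E(a', b') ≤ E(a, b)`. In particular the `(N, M_min)` sector carries the `N`-electron minimum. -/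
theorem Model.energy_le_energy_of_max_le {F : Model k} (hF : F.IsSymmetric) {a b a' b' : ℕ}
    (ha : a ≤ k) (hb : b ≤ k) (hsum : a' + b' = a + b) (hmax : max a' b' ≤ max a b) :
    F.energy a' b' ≤ F.energy a b :=
  sectorGroundEnergy_le_of_abs_le (F.hamiltonian_isHermitian hF) F.preservesSectors_hamiltonian
    (molecularHamiltonian_commute_spinMinus _ _ _) F.relabel_spinSwap_hamiltonian
    (by simpa using ha) (by simpa using hb) hsum (abs_sub_le_abs_sub_of_max_le hsum hmax)

/-- **`E₀(a + b) = E(a, b)` for every nearly balanced realised sector** (`a, b ≤ k`, `|a − b| ≤ 1`)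
of a symmetric model: the row's sector energy IS the `N`-electron ground energy of the model. -/
theorem Model.groundEnergy_eq_energy_of_le_succ {F : Model k} (hF : F.IsSymmetric) {a b : ℕ}
    (ha : a ≤ k) (hb : b ≤ k) (hab : a ≤ b + 1) (hba : b ≤ a + 1) :
    groundEnergy F.hamiltonian (a + b) = F.energy a b :=
  groundEnergy_eq_sectorGroundEnergy_of_su2 (F.hamiltonian_isHermitian hF)
    F.preservesSectors_hamiltonian (molecularHamiltonian_commute_spinPlus _ _ _)
    (molecularHamiltonian_commute_spinMinus _ _ _) (by simpa using ha) (by simpa using hb) hab hba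

/-- **Odd electron number**: `E₀(H_F; 2n + 1) = E(n + 1, n)` for a symmetric model and `n + 1 ≤ k`
(the doublet-type sector `S_z = +½`). -/
theorem Model.groundEnergy_eq_energy_odd {F : Model k} (hF : F.IsSymmetric) {n : ℕ}
    (hn : n + 1 ≤ k) : groundEnergy F.hamiltonian (2 * n + 1) = F.energy (n + 1) n := by
  rw [show 2 * n + 1 = (n + 1) + n by ring]
  exact Model.groundEnergy_eq_energy_of_le_succ hF hn (by omega) (by omega) (by omega)

/-- **Odd electron number, `S_z = −½`**: `E₀(H_F; 2n + 1) = E(n, n + 1)`. -/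
theorem Model.groundEnergy_eq_energy_odd' {F : Model k} (hF : F.IsSymmetric) {n : ℕ}
    (hn : n + 1 ≤ k) : groundEnergy F.hamiltonian (2 * n + 1) = F.energy n (n + 1) := by
  rw [Model.groundEnergy_eq_energy_odd hF hn, Model.energy_symm]

/-- **Both parities at once**: `E₀(H_F; N) = E(⌈N/2⌉, ⌊N/2⌋)` for a symmetric model whenever the
sector is realised (`⌈N/2⌉ ≤ k`) — the `M = (N mod 2)/2` sector of FANOUT row 57. -/
theorem Model.groundEnergy_eq_energy_halves {F : Model k} (hF : F.IsSymmetric) {N : ℕ}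
    (hN : (N + 1) / 2 ≤ k) : groundEnergy F.hamiltonian N = F.energy ((N + 1) / 2) (N / 2) := by
  have h := Model.groundEnergy_eq_energy_of_le_succ hF hN (le_trans (by omega) hN : N / 2 ≤ k)
    (by omega) (by omega)
  rwa [show (N + 1) / 2 + N / 2 = N by omega] at h

/-! ## Row readings for arbitrary sectors -/

/-- **An UPPER row in ANY sector bounds the `N`-electron ground energy of the model from above**
(`N = N_α + N_β`; no symmetry of the model needed). -/
theorem UpperRow.groundEnergy_le_of_sector {F : Model k} {a b : ℕ} {hi : ℚ} (h : UpperRow F a b hi) :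
    groundEnergy F.hamiltonian (a + b) ≤ ((hi : ℚ) : ℝ) :=
  (F.groundEnergy_le_energy h.range.1 h.range.2).trans h.le

/-- **A LOWER row in a nearly balanced sector (`|N_α − N_β| ≤ 1`) bounds the `N`-electron ground
energy of a symmetric model from below.** -/
theorem LowerRow.le_groundEnergy_of_le_succ {F : Model k} (hF : F.IsSymmetric) {a b : ℕ} {lo : ℚ}
    (h : LowerRow F a b lo) (hab : a ≤ b + 1) (hba : b ≤ a + 1) :
    ((lo : ℚ) : ℝ) ≤ groundEnergy F.hamiltonian (a + b) := by
  rw [Model.groundEnergy_eq_energy_of_le_succ hF h.range.1 h.range.2 hab hba]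
  exact h.le

/-- A bracket in a nearly balanced sector brackets the `N`-electron ground energy of the model. -/
theorem Bracket.groundEnergy_mem_of_le_succ {F : Model k} (hF : F.IsSymmetric) {a b : ℕ}
    {lo hi : ℚ} (h : Bracket F a b lo hi) (hab : a ≤ b + 1) (hba : b ≤ a + 1) :
    ((lo : ℚ) : ℝ) ≤ groundEnergy F.hamiltonian (a + b) ∧
      groundEnergy F.hamiltonian (a + b) ≤ ((hi : ℚ) : ℝ) :=
  ⟨h.1.le_groundEnergy_of_le_succ hF hab hba, h.2.groundEnergy_le_of_sector⟩

/-- **A LOWER row in a nearly balanced sector bounds EVERY realised sector of the same electron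
number from below** (`a' + b' = a + b`, `a', b' ≤ k`): the `(N, M_min)` row is an `N`-sector row in
the strongest sense. -/
theorem LowerRow.le_energy_of_sameN {F : Model k} (hF : F.IsSymmetric) {a b : ℕ} {lo : ℚ}
    (h : LowerRow F a b lo) (hab : a ≤ b + 1) (hba : b ≤ a + 1) {a' b' : ℕ} (ha' : a' ≤ k)
    (hb' : b' ≤ k) (hsum : a' + b' = a + b) : ((lo : ℚ) : ℝ) ≤ F.energy a' b' :=
  h.le.trans (Model.energy_le_energy_of_max_le hF ha' hb' hsum.symm (by omega))

end Summit.Ventures.CertifiedQuantumChemistry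

end
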